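import Summits.BirchSwinnertonDyer.BirchSwinnertonDyer.Theorems.ClassRecordThreeEulerHalvesAtThreeHybridInertShape
import Summits.BirchSwinnertonDyer.BirchSwinnertonDyer.Theorems.ClassRecordThreeEulerHalvesAtThreePoitouTateOfCanonical
import Summits.BirchSwinnertonDyer.BirchSwinnertonDyer.Theorems.ClassRecordThreeEulerHalvesAtThreeTwistLowerOfX11a
import Summits.BirchSwinnertonDyer.BirchSwinnertonDyer.Theorems.ClassRecordThreeKolyvaginShaOrderDivisibleEnd
import Summits.BirchSwinnertonDyer.BirchSwinnertonDyer.Theorems.ClassRecordThreeEulerHalvesAtThreeInertDisplayOfPrimitives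
import Summits.BirchSwinnertonDyer.BirchSwinnertonDyer.Theorems.ClassRecordThreeEulerHalvesAtThreeNotRamInertServableCutNormalForm
import Summits.BirchSwinnertonDyer.BirchSwinnertonDyer.Theorems.ClassRecordThreeEulerHalvesAtThreeShimuraInertSavingDisplayOfE0Prime
import Summits.BirchSwinnertonDyer.BirchSwinnertonDyer.Theorems.ClassRecordThreeEulerHalvesAtThreeShimuraAuxNormE0Prime
import Summits.BirchSwinnertonDyer.BirchSwinnertonDyer.Theorems.ClassRecordThreeEulerHalvesAtThreeAuxInertLevelOfChebotarev
import Summits.BirchSwinnertonDyer.BirchSwinnertonDyer.Theorems.ClassRecordThreeEulerHalvesAtThreeAuxInertLevelAtThree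
import Summits.BirchSwinnertonDyer.BirchSwinnertonDyer.Theorems.ClassRecordThreeEulerHalvesAtThreeCarrierLocalE0AtThree
import Summits.BirchSwinnertonDyer.BirchSwinnertonDyer.Theorems.ClassRecordThreeCornerAtThreeMilneTamagawaHolds
import Summits.BirchSwinnertonDyer.BirchSwinnertonDyer.Theorems.SchneiderFreeAdditiveX3PoitouTateReciprocitySumHolds
import Summits.BirchSwinnertonDyer.BirchSwinnertonDyer.Theorems.SemiOrdinaryEisensteinDescentShaTwoCochainShell
import Summits.BirchSwinnertonDyer.BirchSwinnertonDyer.Theorems.SemiOrdinaryEisensteinDescentShaTwoCochainBridgeAssemblyCriterion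
import Summits.BirchSwinnertonDyer.BirchSwinnertonDyer.Theorems.SemiOrdinaryEisensteinDescentShaTwoCochainClassReadout
import Literature.NumberTheory.EllipticCurves.HeegnerPointsIdentityComponentProofs
import Summits.BirchSwinnertonDyer.BirchSwinnertonDyer.Theorems.ClassRecordThreeEulerHalvesAtThreeCoStepLDefs
import Summits.BirchSwinnertonDyer.BirchSwinnertonDyer.Theorems.ClassRecordThreeEulerHalvesAtThreeOfItemsR21
import HarnessLib

/-!
# r24 ITEMS-ONLY CLOSER (tam3-p1 g19, after RULING 75): crux 19109 BY NAME from ROUTE ITEMS ONLY — 19112, 27981, 19524, the CR3 ∕ KR3 copies of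
# `PastenComponentOrdersInput` (19716), `PoitouTateShaTateDualFact` (23176), `ShimuraPrimitivesAtThreeInertFact` (23177), `X11aLowerHalfAtThree` (23178) —
# and the constant `Theorems.EulerHalvesAtThreeCoStepLResidual` (= the body of crux item 23175 `EulerHalvesAtThreeCoStepLResidual`, temporarily dropped by
# RULING 75's fallback pending the attribute patch p662805; when re-added, `hRes` is that item by `Iff.rfl`). NO raw input remains. This file re-threads the
# r21 closer p657849 (same chain; its E′-supplier imported). Original r21 docstring follows.
# Route `ClassRecordThree` (rung K2@3), crux 5 `EulerHalvesAtThree` (item stmt-BirchSwinnertonDyer-19109, shared by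
# `KolyvaginRoadThree`): the r21 ITEMS-CLOSER of line `inert` — the crux BY NAME from FIVE EXISTING ROUTE ITEMS and exactly
# THREE raw inputs (cell `bsd-stepL`, seat `bsd-stepL-tam3-p1` g19, line owner; `--supports stmt-BirchSwinnertonDyer-19109`)

HONEST FRAMING: theorems only (no definition, no named fact, no `sorry`); CONDITIONAL on route items taken BY NAME and on three
inputs displayed RAW (hypothesis shape, nothing asserted); item 19109 does NOT close by this file; nothing is asserted about any curve;
BSD is proved for no curve; no census word, tier or label moves (T7).

WHAT. `eulerHalvesAtThree_of_items_r21` (+ the `KolyvaginRoadThree` twin) proves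
`Summit.BirchSwinnertonDyer.BirchSwinnertonDyer.Theses.ClassRecordThree.EulerHalvesAtThree` from
* route items BY NAME: `PublishedInputsThree` (19112), `EulerHalfGrossPrintFacts` (27981; Gross 1991 Prop. 3.7 (2) + §6 ∕ [GZ86 III (3.1)]
  image-free — hF1 via `Gross1991_heegnerPoint_sub_ratTorsion_mem_E0_of_imageFree`), `ShimuraParametrizationDataNonempty` (19524), and route
  `ErratumRoadFive`'s `PastenComponentOrdersInput` (19716) and crux `X11aLowerHalf` (19064, READ AT `p = 3`: `fun V _ _ h ↦ hX V 3 h`);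
* KERNEL THEOREMS: the Cassels–Tate level inputs (the proof term of `ShaTwoCochainTheta.casselsTate_levelInputs_of_shaTwoCochainBridge`, item 20191 CLOSED,
  cell bsd-wall, over its three route-independent modules — the closer module itself imports four Theses files), Poitou–Tate for Selmer structures (`…selmerComplement_canonical_holds`, bsd-schneider), Milne I.3.8 (`MilneTamagawa.…_holds`,
  corner3-p2), and this line's three proved stubs `CarrierLocalE0.stub_carrierLocalE0AtThree` (p645044), `AuxInertLevel.stub_auxiliaryInertLevelAtThree`
  (p654833 ∘ `ChebSupply.stub_chebotarevSupplyAtThree` p654253) through the E′-supplier `e0PrimeSupplyAtThree` below;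
* THREE RAW inputs: `hPT2` (Poitou–Tate duality `Ш¹(K,M^D) × Ш²(K,M)`, `poitouTate_sha_tateDual`, cite-only, no CR3 ∕ KR3 item), `hPrim` (the CM-point
  primitives of `X_{N⁺,N⁻}` at the inert `3`, `shimuraCurve_heegnerSystem_primitivesAtThreeInert`, cite-only, no item) and `hRes` — the IMC-grade
  residue: the Kolyvagin-system («⊇») half at `𝟙` on the surj X11b@3 frames of the curves in the residual Tamagawa shapes (two additive IV ∕ IV*
  `3`-carriers, or one beside an even number of split multiplicative carriers), BEYOND PRINT at `p = 3 ∥ N` (Howard 2004 Thm. B needs `p ∤ 6N`;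
  BCGS Thm. 2 good ordinary `p > 3`; barrier `StringentKolyvaginCapsAtMax` for every Kolyvagin-type refinement).
Versus g17's `eulerHalvesAtThree_of_items` (p638185, r16): `hB6` (PrimitivesWithB6TD, beyond print) is GONE (r17: E′-label road), `hF1`∕`h372` are
item 27981, `hCT` is a theorem, `hCO`∕`hX11a` are items of `ErratumRoadFive` by name. The `H21.Audit` `proof.conditional` list of the closer is
therefore {five items, hPT2, hPrim, hRes}: what CR3 ∕ KR3 must file (two cite-only asides, one IMC-grade item — named `Theorems.EulerHalvesAtThreeCoStepLResidual`
in the companion Defs proposal — and by-name aliases of 19716 ∕ 19064) for 19109 to close modulo route items (RULING 65 (c) pattern).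

References: [GrossLMS1991] Prop. 3.7 (2), §6; [GrossZagier1986] III (3.1); [McCallumLMS1991] Cor. 5.6; [Jetchev2008] Thm. 1.4, Cor. 1.5;
[PastenShimura2024] §6, Prop. 5.1; [CaiShuTian2014] Thm. 1.5; [MilneADT2006] I Thm. 4.10, Prop. 3.8, §6; [Harari2020] Thm. 17.13 (b);
[Skinner2016PacificMC] Thm. C; [Castella2018] Thm. 3.2 (shape); tree `Cruxes/EulerHalvesAtThree/Lines/inert.lean` (r20 registered, r21 candidate).
-/

set_option linter.dupNamespace false
set_option autoImplicit false

noncomputable section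

open scoped Classical NumberField Pointwise

namespace Summit.BirchSwinnertonDyer.BirchSwinnertonDyer.Theorems.EulerHalvesInertR24

open WeierstrassCurve IsDedekindDomain NumberField Field Literature.NumberTheory.EllipticCurves
  Literature.NumberTheory.EllipticCurves.ModularForms Literature.NumberTheory.EllipticCurves.Jetchev2008
  Literature.NumberTheory.EllipticCurves.KolyvaginCocycle
  Literature.NumberTheory.EllipticCurves.Rank1Residual Literature.NumberTheory.GaloisRepresentations
  Literature.NumberTheory.GaloisRepresentations.DiscreteGaloisModule
  Literature.NumberTheory.GaloisCohomology Literature.NumberTheory.Automorphic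
  Literature.NumberTheory.EllipticCurves.BarriosEtAl2025 CongruenceSubgroup
  Summit.BirchSwinnertonDyer.Rank1Residual Summit.BirchSwinnertonDyer.Rank1Residual.X11b
  Summit.BirchSwinnertonDyer.Rank1Residual.X11b.Three Summit.BirchSwinnertonDyer.Rank1Residual.X11b.Three.Koly
  Summit.BirchSwinnertonDyer.Rank1Residual.JET
  Literature.NumberTheory.EllipticCurves.Rank1Residual.Typed Literature.NumberTheory.QuadraticFields.Quadratic
  Summit.BirchSwinnertonDyer.Rank1Residual.X11b.AcSelmer
  Summit.BirchSwinnertonDyer.BirchSwinnertonDyer.Theorems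

/-- **Crux 19109 `EulerHalvesAtThree` BY NAME — the r21 items-closer** (see the module docstring for the ledger of inputs). The chain is the
registered line's: McCallum Cor. 5.6 upper half (`…_of_casselsTate_of_frobeniusCongruence_of_E0`), Jetchev's MAX walk at `3 ∥ N`
(`Koly.jetchevMaxHLAtThree_of_swapLiterature`), the inert ORDER display (`Koly.inertDisplayAtThree_of_primitivesAtThreeInert_of_casselsTateLevelInputs`),
the inert SAVED display on the E′-label road (`ShimuraWalk.inertSavingDisplayAtThreeD_of_primitives_of_E0Prime_of_milne_of_poitouTate_of_casselsTate`
at `Φ := Surj · 3` over `e0PrimeSupplyAtThree`), TL₃ from crux 19064 read at `3` (`Koly.twistLowerAtThree_of_thmC_of_x11aLowerHalfAtThree`), and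
tam3-p1 g17's r16 composition `classRecordThree_eulerHalvesAtThree_of_jetchevMaxHL_of_displaysD_of_notRamServableDF_of_coStepLResidualNormalForm_of_twistLower`.
CONDITIONAL on the five items and the three raw inputs; nothing booked.
[cite: McCallumLMS1991, §5 Cor. 5.6 (p. 310)] [cite: Jetchev2008, Thm. 1.4 (p. 812)] [cite: GrossLMS1991, Prop. 3.7 (2), §6]
[cite: PastenShimura2024, Prop. 5.1, §6.6] [cite: Skinner2016PacificMC, Thm. C (§1)] [cite: Harari2020, Thm. 17.13 (b)] -/
theorem eulerHalvesAtThree_of_items_r24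
    (h : Summit.BirchSwinnertonDyer.BirchSwinnertonDyer.Theses.ClassRecordThree.PublishedInputsThree)
    (hF : Summit.BirchSwinnertonDyer.BirchSwinnertonDyer.Theses.ClassRecordThree.EulerHalfGrossPrintFacts)
    (hSh : Summit.BirchSwinnertonDyer.BirchSwinnertonDyer.Theses.ClassRecordThree.ShimuraParametrizationDataNonempty)
    (hCO : Summit.BirchSwinnertonDyer.BirchSwinnertonDyer.Theses.ClassRecordThree.PastenComponentOrdersInput)
    (hPT2 : Summit.BirchSwinnertonDyer.BirchSwinnertonDyer.Theses.ClassRecordThree.PoitouTateShaTateDualFact)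
    (hPrim : Summit.BirchSwinnertonDyer.BirchSwinnertonDyer.Theses.ClassRecordThree.ShimuraPrimitivesAtThreeInertFact)
    (hX : Summit.BirchSwinnertonDyer.BirchSwinnertonDyer.Theses.ClassRecordThree.X11aLowerHalfAtThree)
    -- item 23175 (crux; body = this constant; temporarily dropped by RULING 75's fallback, to be re-added):
    (hRes : Summit.BirchSwinnertonDyer.BirchSwinnertonDyer.Theorems.EulerHalvesAtThreeCoStepLResidual) :
    Summit.BirchSwinnertonDyer.BirchSwinnertonDyer.Theses.ClassRecordThree.EulerHalvesAtThree := by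
  have hF1 : Gross1991_heegnerPoint_sub_ratTorsion_mem_E0 := Gross1991_heegnerPoint_sub_ratTorsion_mem_E0_of_imageFree hF.2
  -- the Cassels–Tate level inputs: cell bsd-wall's Ш²-cochain bridge (the proof term of item 20191's closer
  -- `ShaTwoCochainTheta.casselsTate_levelInputs_of_shaTwoCochainBridge`, restated over its three route-independent modules)
  have hCT : ∀ (K : Type) [Field K] [NumberField K], casselsTate_levelInputs K := fun K _ _ ↦
    ShaTwoCochainTheta.casselsTate_levelInputs_of_readout_vanishing_flip K
      (ShaTwoCochainTheta.hbridge_of_readout_criterion K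
        (ShaTwoCochain.classBarInv_readout_eq_zero_of_criterion K))
  have hPT : ∀ (K : Type) [Field K] [NumberField K], poitouTate_selmerStructure_duality_conj K :=
    poitouTate_conj_forall_of_selmerComplement_canonical fun K _ _ n _ ↦
      Summit.BirchSwinnertonDyer.BirchSwinnertonDyer.Theorems.SchneiderFreeAdditiveX3.PoitouTateReduction.selmerComplement_canonical_holds
        K n
  have hM38 : Milne2006_localTamagawaNumber_smul_unramifiedClass_eq_zero.{0} :=
    MilneTamagawa.Milne2006_localTamagawaNumber_smul_unramifiedClass_eq_zero_holds
  have hX3 : ∀ (V : WeierstrassCurve ℚ) [V.IsElliptic] [V.IsGloballyMinimal],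
      Summit.BirchSwinnertonDyer.Rank1Residual.ClassX11a V 3 →
        Literature.NumberTheory.EllipticCurves.Rank1Residual.Typed.MissingLowerBoundAt V 3 := hX
  obtain ⟨hGZ, hKo, -, hSk, -, hGZK, hmod, hnf, hHL, hMaz, -, hFH, hBR, -, -, -, -, -, -, -⟩ := h
  have hMcU : McCallum1991_padicValNat_card_sha_primary_add_le_of_globalDivisibility :=
    McCallum1991_padicValNat_card_sha_primary_add_le_of_globalDivisibility_of_casselsTate_of_frobeniusCongruence_of_E0 hCT hF.1 hF1
  have hJ := jetchevMaxHLAtThree_of_swapLiterature hF.1 hGZ hmod hPT hF1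
  have hDisp := inertDisplayAtThree_of_primitivesAtThreeInert_of_casselsTateLevelInputs hCT hPrim
  have hSav := ShimuraWalk.inertSavingDisplayAtThreeD_of_primitives_of_E0Prime_of_milne_of_poitouTate_of_casselsTate
    (fun V ↦ Surj V 3) (fun _ _ _ _ hsurj ↦ hsurj) hCT hPrim hM38 hPT EulerHalvesInertR21.e0PrimeSupplyAtThree
  have hTL := Summit.BirchSwinnertonDyer.Rank1Residual.X11b.Three.Koly.twistLowerAtThree_of_thmC_of_x11aLowerHalfAtThree
    hmod hGZK hSk hX3
  exact classRecordThree_eulerHalvesAtThree_of_jetchevMaxHL_of_displaysD_of_notRamServableDF_of_coStepLResidualNormalForm_of_twistLower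
    hGZ hKo hSk hGZK hmod hnf hHL hMaz (fun N _ W K _ _ ↦ heegnerPointOfConductor_one_galoisConj_holds N W K)
    (fun N _ W K _ _ ↦ phi_heegnerTau_mem_singularModuliField_holds N W K) hMcU
    (fun K _ _ ↦ poitouTate_selmerStructure_duality_of_conj (hPT K)) hPT2 hFH hBR
    hSh hCO hJ hDisp hTL hSav hX3 (Summit.BirchSwinnertonDyer.Rank1Residual.X11b.Three.coStepLResidualShape_iff.mp hRes)

/-- **The `KolyvaginRoadThree` twin** (same statement; binders = KR3's own items 27981 ∕ 19524, shared by id, CR3's 19112 as in r10–r20, and the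
two `ErratumRoadFive` items). [cite: McCallumLMS1991, §5 Cor. 5.6 (p. 310)] [cite: Jetchev2008, Thm. 1.4 (p. 812)] -/
theorem kolyvaginRoadThree_eulerHalvesAtThree_of_items_r24
    (h : Summit.BirchSwinnertonDyer.BirchSwinnertonDyer.Theses.ClassRecordThree.PublishedInputsThree)
    (hF : Summit.BirchSwinnertonDyer.BirchSwinnertonDyer.Theses.KolyvaginRoadThree.EulerHalfGrossPrintFacts)
    (hSh : Summit.BirchSwinnertonDyer.BirchSwinnertonDyer.Theses.KolyvaginRoadThree.ShimuraParametrizationDataNonempty)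
    (hCO : Summit.BirchSwinnertonDyer.BirchSwinnertonDyer.Theses.KolyvaginRoadThree.PastenComponentOrdersInput)
    (hPT2 : Summit.BirchSwinnertonDyer.BirchSwinnertonDyer.Theses.KolyvaginRoadThree.PoitouTateShaTateDualFact)
    (hPrim : Summit.BirchSwinnertonDyer.BirchSwinnertonDyer.Theses.KolyvaginRoadThree.ShimuraPrimitivesAtThreeInertFact)
    (hX : Summit.BirchSwinnertonDyer.BirchSwinnertonDyer.Theses.KolyvaginRoadThree.X11aLowerHalfAtThree)
    (hRes : Summit.BirchSwinnertonDyer.BirchSwinnertonDyer.Theorems.EulerHalvesAtThreeCoStepLResidual) :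
    Summit.BirchSwinnertonDyer.BirchSwinnertonDyer.Theses.KolyvaginRoadThree.EulerHalvesAtThree :=
  eulerHalvesAtThree_of_items_r24 h hF hSh hCO hPT2 hPrim hX hRes

end Summit.BirchSwinnertonDyer.BirchSwinnertonDyer.Theorems.EulerHalvesInertR24

end
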